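import Mathlib
import HarnessLib
import Summits.HubbardSuperconductivity.HubbardSuperconductivity.Theorems.KLProgrammeC4aPPKernelTrueProductForm

/-!
# Route `KLProgramme` — crux C4a, S3 brick (B4) «(B4)-UMK1», «(M1)-STRIP-KERNEL»: the SCALE-REGULAR ENVELOPE of the true pp pair kernel on the FERMI STRIP
# `|e| ≤ Λ` — `|∂ᵤP(e,u)| ≤ (128B₁ + 72)·max(Λ,|u|)⁻¹²` for every partner level `u`, `T`-free

Cell `gate-hubbard-kl`, seat hubbard-kl-k3c3-p1 (g16; row «δμ-flow with klAngularMean constant piece»).  Located brick for the (U1) chain of hubbard-kl-k3c3-p3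
(g32, «(U1)-NEG-PRE», the strip law `…C4aFoldBoxPreLawStrip`) / the (C)-closer lane (stub (C) `stub_twoLeg_curvature` of `KLRegimeEngineV17F2`,
stmt-HubbardSuperconductivity-20437); memo HOME/hubbard-kl-k3c3-p1/g16-M1-NEG-PRE-KERNEL.md §3.

WHY.  k3c3-p3's pre-caustic law now covers every loop level `|e| ≤ hi` in three pieces: `e ∈ [lo,hi]` (flatness number, this seat's `…TrueFlatnessShape`),
`e ∈ [−hi,−lo]` (diagonal majorant, `…C4aPPKernelNegPreDiagonal`) and the FERMI STRIP `|e| ≤ lo`, where `…C4aFoldBoxPreLawStrip.abs_levelLine_partnerBand_pre_strip_le`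
asks ONE kernel row: the scale-regular envelope `|(K e)′u| ≤ 1/max(lo,|u|)²` (normalised) for `|e| ≤ lo`.  The signed envelopes of `…TrueSignedDeriv`/`…TrueProductForm`
are `max(e,|u|)⁻²`-shaped and blow up as `e, u → 0`; they cannot serve.  What is true — and typed here — is that on the strip the kernel is REGULAR AT THE SCALE:
below the shell only frequencies with `ωₙ² + x² ≥ Λ²/4` survive the above-scale weight `W(ωₙ,x)` (`…HubbardUVSymbolSmooth.uvWeightFn_eq_zero_of_lt`), so every
denominator of the `∂ᵤP` series is `≥ Λ²/4` where its weight is alive, and the frequency sums are the counting-free `(2/β)Σ 1/(ωₙ² + (Λ/2)²) ≤ 1/Λ`.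
* §1 **`abs_ppTrueKernelDu_summand_strip_le`**: for `|e| ≤ Λ` and every `u`, the `n`-th summand of `ppTrueKernelDu` is `≤ (32B₁ + 18)/(Λ·(ωₙ² + (Λ/2)²))`
  (three terms: cutoff-derivative term via `abs_pairSummand_core_le` and the shell majorant `abs_uvWeightFnD1_le_shell`; the `W(u)·e` term via `|e|/(ωₙ²+e²) ≤ 4/Λ`
  on the loop weight's support; the `2u(eu+ω²)` term via `2Λ|u||eu+ω²| ≤ 5(ω²+e²)(ω²+u²)` — Cauchy–Schwarz `(eu+ω²)² ≤ (ω²+e²)(ω²+u²)` — on both supports; no `1/ωₙ`,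
  hence no `β`).
* §2 **`abs_ppTrueKernelDu_strip_le_unif`**: `|e| ≤ Λ ⟹ |∂ᵤP(e,u)| ≤ (32B₁ + 18)/Λ²` for EVERY `u ∈ ℝ`.
* §3 **`abs_ppTrueKernelDu_farPartner_le`**: `|e| ≤ Λ`, `2Λ ≤ |u| ⟹ |∂ᵤP(e,u)| ≤ 8/u²` (`∂ᵤP = ∂ᵤN/(e+u) − N/(e+u)²`, `|e+u| ≥ |u|/2`, `|∂ᵤN| ≤ 2/|u|`
  (`…TrueSigned.abs_ppTrueNumeratorDu_le_two_div_abs`), `|N| ≤ 1`).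
* §4 **`abs_ppTrueKernelDu_strip_le_inv_max_sq`** (HEADLINE): `|e| ≤ Λ ⟹ |∂ᵤP(e,u)| ≤ (128B₁ + 72)·(max Λ |u|)⁻¹²` for every `u`; the `deriv` form; and the
  binder shape of the strip law for any floor `0 < lo ≤ Λ`: **`abs_deriv_ppTrueKernel_strip_le`** `∀ e ∈ [−lo,lo], ∀ u, |deriv (P(e,·)) u| ≤ (128B₁+72)·(max lo |u|)⁻¹²`.
Pure real analysis on Literature objects; nothing asserts (C), K3, the window or superconductivity.
References: BGM 2006 §2.4 (2.36) [cite: BenfattoGiulianiMastropietro2006]; Salmhofer 1999 §4.2.5 (4.70)–(4.71) [cite: Salmhofer1999].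
-/

noncomputable section

namespace Summit.HubbardSuperconductivity.HubbardSuperconductivity.Theorems.C4a

set_option linter.dupNamespace false -- summit = problem name (single-conjunct summit), D-0017

open Real Filter Set
open scoped Topology
open Literature.MathematicalPhysics.QuantumLattice Literature.Analysis.SpecialFunctions

/-! ## §1 The summand of `∂ᵤP` on the strip: every live denominator is `≥ Λ²/4` -/

/-- Where the partner weight's DERIVATIVE is alive the partner line is inside the shell: `W′(ω,x) ≠ 0 ⟹ Λ²/4 ≤ x² + ω²`. [cite: Salmhofer1999, §4.2.5 (4.71)] -/
theorem sq_add_sq_ge_of_uvWeightFnD1_ne_zero {Λ : ℝ} (hΛ : 0 < Λ) {ω x : ℝ} (hW : uvWeightFnD1 Λ ω x ≠ 0) : Λ ^ 2 / 4 ≤ x ^ 2 + ω ^ 2 := by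
  by_contra h
  exact hW (uvWeightFn_eq_zero_of_lt hΛ (not_le.1 h)).2.1

/-- On the half shell `Λ²/4 ≤ x² + ω²`: `1/(ω² + x²) ≤ 2/(ω² + (Λ/2)²)` and `1/(ω² + x²) ≤ 4/Λ²`. [folklore] -/
theorem inv_denominator_le_of_shell {Λ ω x : ℝ} (hΛ : 0 < Λ) (hs : Λ ^ 2 / 4 ≤ x ^ 2 + ω ^ 2) :
    1 / (ω ^ 2 + x ^ 2) ≤ 2 / (ω ^ 2 + (Λ / 2) ^ 2) ∧ 1 / (ω ^ 2 + x ^ 2) ≤ 4 / Λ ^ 2 := by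
  have h4 : 0 < Λ ^ 2 / 4 := by positivity
  have hq : 0 < ω ^ 2 + x ^ 2 := by linarith
  refine ⟨?_, ?_⟩
  · rw [div_le_div_iff₀ hq (by positivity)]; nlinarith [sq_nonneg ω]
  · rw [div_le_div_iff₀ hq (by positivity)]; nlinarith

/-- Strip term 1 (the cutoff-derivative term): with the loop weight alive (`Λ²/4 ≤ e² + ω²`, `ω ≠ 0`),
`|W′(ω,u)·(eu+ω²)/((ω²+e²)(ω²+u²))| ≤ 32B₁/(Λ·(ω² + (Λ/2)²))`. [cite: Salmhofer1999, §4.2.5 (4.71)] -/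
theorem abs_stripTerm1_le {Λ : ℝ} (hΛ : 0 < Λ) {B₁ : ℝ} (hB₁ : ∀ x, |deriv salmhoferCutoff x| ≤ B₁) {ω e : ℝ} (hω : ω ≠ 0)
    (hAs : Λ ^ 2 / 4 ≤ e ^ 2 + ω ^ 2) (u : ℝ) :
    |uvWeightFnD1 Λ ω u * (e * u + ω ^ 2) / ((ω ^ 2 + e ^ 2) * (ω ^ 2 + u ^ 2))| ≤ 32 * B₁ / (Λ * (ω ^ 2 + (Λ / 2) ^ 2)) := by
  have hB0 := salmhoferB₁_nonneg hB₁
  have hD0 : 0 < ω ^ 2 + (Λ / 2) ^ 2 := by positivity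
  by_cases hW1z : uvWeightFnD1 Λ ω u = 0
  · rw [hW1z, zero_mul, zero_div, abs_zero]; positivity
  have hBs : Λ ^ 2 / 4 ≤ u ^ 2 + ω ^ 2 := sq_add_sq_ge_of_uvWeightFnD1_ne_zero hΛ hW1z
  have hAinv := (inv_denominator_le_of_shell hΛ hAs).2
  have hBinv := (inv_denominator_le_of_shell hΛ hBs).2
  have hcore := abs_pairSummand_core_le hω e u
  have hshell := abs_uvWeightFnD1_le_shell hB₁ hΛ ω u
  have h8 : (8 : ℝ) / Λ ^ 2 = 4 / Λ ^ 2 + 4 / Λ ^ 2 := by ring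
  have hcore' : |(e * u + ω ^ 2) / ((ω ^ 2 + e ^ 2) * (ω ^ 2 + u ^ 2))| ≤ 8 / Λ ^ 2 := by rw [h8]; linarith
  have hfrac : 2 * Λ ^ 2 / (ω ^ 2 + Λ ^ 2) ≤ 2 * Λ ^ 2 / (ω ^ 2 + (Λ / 2) ^ 2) :=
    div_le_div_of_nonneg_left (by positivity) hD0 (by nlinarith)
  have hshell' : |uvWeightFnD1 Λ ω u| ≤ 2 * B₁ / Λ * (2 * Λ ^ 2 / (ω ^ 2 + (Λ / 2) ^ 2)) :=
    hshell.trans (mul_le_mul_of_nonneg_left hfrac (by positivity))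
  rw [mul_div_assoc, abs_mul]
  calc |uvWeightFnD1 Λ ω u| * |(e * u + ω ^ 2) / ((ω ^ 2 + e ^ 2) * (ω ^ 2 + u ^ 2))|
      ≤ 2 * B₁ / Λ * (2 * Λ ^ 2 / (ω ^ 2 + (Λ / 2) ^ 2)) * (8 / Λ ^ 2) := mul_le_mul hshell' hcore' (abs_nonneg _) (by positivity)
    _ = 32 * B₁ / (Λ * (ω ^ 2 + (Λ / 2) ^ 2)) := by field_simp; ring

/-- Strip term 2 (the `W(u)·e` term): loop weight alive and `|e| ≤ Λ` ⟹ `|W(ω,u)·e/((ω²+e²)(ω²+u²))| ≤ 8/(Λ·(ω² + (Λ/2)²))`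
(`|e|/(ω²+e²) ≤ 4/Λ`; `W(ω,u)/(ω²+u²) ≤ 2/(ω²+(Λ/2)²)` on the partner weight's support). [cite: Salmhofer1999, §4.2.5 (4.71)] -/
theorem abs_stripTerm2_le {Λ : ℝ} (hΛ : 0 < Λ) {ω e : ℝ} (hω : ω ≠ 0) (hAs : Λ ^ 2 / 4 ≤ e ^ 2 + ω ^ 2) (he : |e| ≤ Λ) (u : ℝ) :
    |uvWeightFn Λ ω u * e / ((ω ^ 2 + e ^ 2) * (ω ^ 2 + u ^ 2))| ≤ 8 / (Λ * (ω ^ 2 + (Λ / 2) ^ 2)) := by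
  have hD0 : 0 < ω ^ 2 + (Λ / 2) ^ 2 := by positivity
  have hA0 : 0 < ω ^ 2 + e ^ 2 := by positivity
  have hB0 : 0 < ω ^ 2 + u ^ 2 := by positivity
  obtain ⟨hWu0, hWu1⟩ := uvWeightFn_mem_Icc Λ ω u
  by_cases hWuz : uvWeightFn Λ ω u = 0
  · rw [hWuz, zero_mul, zero_div, abs_zero]; positivity
  have hBs : Λ ^ 2 / 4 ≤ u ^ 2 + ω ^ 2 := sq_add_sq_ge_of_uvWeightFn_ne_zero hΛ hWuz
  have hBinv := (inv_denominator_le_of_shell hΛ hBs).1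
  have heA : |e| / (ω ^ 2 + e ^ 2) ≤ 4 / Λ := by
    rw [div_le_div_iff₀ hA0 hΛ]
    have : |e| * Λ ≤ Λ * Λ := mul_le_mul_of_nonneg_right he hΛ.le
    nlinarith
  have hsplit : uvWeightFn Λ ω u * e / ((ω ^ 2 + e ^ 2) * (ω ^ 2 + u ^ 2)) =
      uvWeightFn Λ ω u * (e / (ω ^ 2 + e ^ 2)) * (1 / (ω ^ 2 + u ^ 2)) := by
    field_simp
  rw [hsplit, abs_mul, abs_mul, abs_of_nonneg hWu0, abs_div, abs_of_pos hA0, abs_of_pos (by positivity : (0 : ℝ) < 1 / (ω ^ 2 + u ^ 2))]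
  calc uvWeightFn Λ ω u * (|e| / (ω ^ 2 + e ^ 2)) * (1 / (ω ^ 2 + u ^ 2)) ≤ 1 * (4 / Λ) * (2 / (ω ^ 2 + (Λ / 2) ^ 2)) :=
        mul_le_mul (mul_le_mul hWu1 heA (by positivity) zero_le_one) hBinv (by positivity) (by positivity)
    _ = 8 / (Λ * (ω ^ 2 + (Λ / 2) ^ 2)) := by field_simp; ring

/-- Strip term 3 (the `2u(eu+ω²)` term): loop weight alive ⟹ `|W(ω,u)·(eu+ω²)·2u/((ω²+e²)(ω²+u²)²)| ≤ 10/(Λ·(ω² + (Λ/2)²))`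
(Cauchy–Schwarz `(eu+ω²)² ≤ (ω²+e²)(ω²+u²)`, hence `2Λ|u||eu+ω²| ≤ 5(ω²+e²)(ω²+u²)` on both supports). [cite: Salmhofer1999, §4.2.5 (4.71)] -/
theorem abs_stripTerm3_le {Λ : ℝ} (hΛ : 0 < Λ) {ω e : ℝ} (hω : ω ≠ 0) (hAs : Λ ^ 2 / 4 ≤ e ^ 2 + ω ^ 2) (u : ℝ) :
    |uvWeightFn Λ ω u * (e * u + ω ^ 2) * (2 * u) / ((ω ^ 2 + e ^ 2) * (ω ^ 2 + u ^ 2) ^ 2)| ≤ 10 / (Λ * (ω ^ 2 + (Λ / 2) ^ 2)) := by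
  have hD0 : 0 < ω ^ 2 + (Λ / 2) ^ 2 := by positivity
  have hA0 : 0 < ω ^ 2 + e ^ 2 := by positivity
  have hB0 : 0 < ω ^ 2 + u ^ 2 := by positivity
  obtain ⟨hWu0, hWu1⟩ := uvWeightFn_mem_Icc Λ ω u
  by_cases hWuz : uvWeightFn Λ ω u = 0
  · rw [hWuz, zero_mul, zero_mul, zero_div, abs_zero]; positivity
  have hBs : Λ ^ 2 / 4 ≤ u ^ 2 + ω ^ 2 := sq_add_sq_ge_of_uvWeightFn_ne_zero hΛ hWuz
  have hBinv := (inv_denominator_le_of_shell hΛ hBs).1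
  -- Cauchy–Schwarz and the key product inequality
  have hCS : (e * u + ω ^ 2) ^ 2 ≤ (ω ^ 2 + e ^ 2) * (ω ^ 2 + u ^ 2) := by
    nlinarith [sq_nonneg (ω * (e - u))]
  have hkey : 2 * |u| * |e * u + ω ^ 2| * Λ ≤ 5 * ((ω ^ 2 + e ^ 2) * (ω ^ 2 + u ^ 2)) := by
    have h4A : Λ ^ 2 ≤ 4 * (ω ^ 2 + e ^ 2) := by linarith
    have huB : u ^ 2 ≤ ω ^ 2 + u ^ 2 := by nlinarith [sq_nonneg ω]
    have h1 : 2 * (Λ * |u|) * |e * u + ω ^ 2| ≤ (Λ * |u|) ^ 2 + |e * u + ω ^ 2| ^ 2 := two_mul_le_add_sq _ _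
    have h2 : (Λ * |u|) ^ 2 = Λ ^ 2 * u ^ 2 := by rw [mul_pow, sq_abs]
    have h3 : |e * u + ω ^ 2| ^ 2 = (e * u + ω ^ 2) ^ 2 := sq_abs _
    have h4 : Λ ^ 2 * u ^ 2 ≤ 4 * (ω ^ 2 + e ^ 2) * (ω ^ 2 + u ^ 2) := by
      calc Λ ^ 2 * u ^ 2 ≤ 4 * (ω ^ 2 + e ^ 2) * u ^ 2 := mul_le_mul_of_nonneg_right h4A (sq_nonneg u)
        _ ≤ 4 * (ω ^ 2 + e ^ 2) * (ω ^ 2 + u ^ 2) := mul_le_mul_of_nonneg_left huB (by positivity)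
    calc 2 * |u| * |e * u + ω ^ 2| * Λ = 2 * (Λ * |u|) * |e * u + ω ^ 2| := by ring
      _ ≤ (Λ * |u|) ^ 2 + |e * u + ω ^ 2| ^ 2 := h1
      _ = Λ ^ 2 * u ^ 2 + (e * u + ω ^ 2) ^ 2 := by rw [h2, h3]
      _ ≤ 4 * (ω ^ 2 + e ^ 2) * (ω ^ 2 + u ^ 2) + (ω ^ 2 + e ^ 2) * (ω ^ 2 + u ^ 2) := add_le_add h4 hCS
      _ = 5 * ((ω ^ 2 + e ^ 2) * (ω ^ 2 + u ^ 2)) := by ring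
  rw [abs_div, abs_mul, abs_mul, abs_of_nonneg hWu0, abs_of_pos (by positivity : (0 : ℝ) < (ω ^ 2 + e ^ 2) * (ω ^ 2 + u ^ 2) ^ 2),
    show |2 * u| = 2 * |u| by rw [abs_mul, abs_of_pos (by norm_num : (0 : ℝ) < 2)]]
  have h1 : uvWeightFn Λ ω u * |e * u + ω ^ 2| * (2 * |u|) ≤ 5 * ((ω ^ 2 + e ^ 2) * (ω ^ 2 + u ^ 2)) / Λ := by
    rw [le_div_iff₀ hΛ]
    calc uvWeightFn Λ ω u * |e * u + ω ^ 2| * (2 * |u|) * Λ ≤ 1 * |e * u + ω ^ 2| * (2 * |u|) * Λ := by gcongr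
      _ = 2 * |u| * |e * u + ω ^ 2| * Λ := by ring
      _ ≤ 5 * ((ω ^ 2 + e ^ 2) * (ω ^ 2 + u ^ 2)) := hkey
  calc uvWeightFn Λ ω u * |e * u + ω ^ 2| * (2 * |u|) / ((ω ^ 2 + e ^ 2) * (ω ^ 2 + u ^ 2) ^ 2)
      ≤ 5 * ((ω ^ 2 + e ^ 2) * (ω ^ 2 + u ^ 2)) / Λ / ((ω ^ 2 + e ^ 2) * (ω ^ 2 + u ^ 2) ^ 2) := by gcongr
    _ = 5 / Λ * (1 / (ω ^ 2 + u ^ 2)) := by field_simp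
    _ ≤ 5 / Λ * (2 / (ω ^ 2 + (Λ / 2) ^ 2)) := mul_le_mul_of_nonneg_left hBinv (by positivity)
    _ = 10 / (Λ * (ω ^ 2 + (Λ / 2) ^ 2)) := by field_simp; ring

/-- **THE STRIP SUMMAND BOUND.**  `0 < β`, `0 < Λ`, `|χ′| ≤ B₁`, `|e| ≤ Λ`: for every `u` and `n`, the `n`-th summand of `ppTrueKernelDu β Λ e u` is
`≤ (32B₁ + 18)/(Λ·(ωₙ² + (Λ/2)²))`. [cite: BenfattoGiulianiMastropietro2006, §2.4 (2.36)] -/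
theorem abs_ppTrueKernelDu_summand_strip_le {β Λ : ℝ} (hβ : 0 < β) (hΛ : 0 < Λ) {B₁ : ℝ} (hB₁ : ∀ x, |deriv salmhoferCutoff x| ≤ B₁) {e : ℝ}
    (he : |e| ≤ Λ) (u : ℝ) (n : ℕ) :
    |uvWeightFn Λ (ppFreq β n) e *
      ((uvWeightFnD1 Λ (ppFreq β n) u * (e * u + ppFreq β n ^ 2) + uvWeightFn Λ (ppFreq β n) u * e) / ((ppFreq β n ^ 2 + e ^ 2) * (ppFreq β n ^ 2 + u ^ 2)) -
        uvWeightFn Λ (ppFreq β n) u * (e * u + ppFreq β n ^ 2) * (2 * u) / ((ppFreq β n ^ 2 + e ^ 2) * (ppFreq β n ^ 2 + u ^ 2) ^ 2))| ≤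
      (32 * B₁ + 18) / (Λ * (ppFreq β n ^ 2 + (Λ / 2) ^ 2)) := by
  have hB0 := salmhoferB₁_nonneg hB₁
  have hω : ppFreq β n ≠ 0 := (ppFreq_pos hβ n).ne'
  have hRHS0 : 0 ≤ (32 * B₁ + 18) / (Λ * (ppFreq β n ^ 2 + (Λ / 2) ^ 2)) := by positivity
  obtain ⟨hWe0, hWe1⟩ := uvWeightFn_mem_Icc Λ (ppFreq β n) e
  by_cases hWez : uvWeightFn Λ (ppFreq β n) e = 0
  · rw [hWez, zero_mul, abs_zero]; exact hRHS0
  have hAs : Λ ^ 2 / 4 ≤ e ^ 2 + ppFreq β n ^ 2 := sq_add_sq_ge_of_uvWeightFn_ne_zero hΛ hWez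
  have hT1 := abs_stripTerm1_le hΛ hB₁ hω hAs u
  have hT2 := abs_stripTerm2_le hΛ hω hAs he u
  have hT3 := abs_stripTerm3_le hΛ hω hAs u
  rw [add_div, abs_mul, abs_of_nonneg hWe0]
  have habs : |uvWeightFnD1 Λ (ppFreq β n) u * (e * u + ppFreq β n ^ 2) / ((ppFreq β n ^ 2 + e ^ 2) * (ppFreq β n ^ 2 + u ^ 2)) +
        uvWeightFn Λ (ppFreq β n) u * e / ((ppFreq β n ^ 2 + e ^ 2) * (ppFreq β n ^ 2 + u ^ 2)) -
        uvWeightFn Λ (ppFreq β n) u * (e * u + ppFreq β n ^ 2) * (2 * u) / ((ppFreq β n ^ 2 + e ^ 2) * (ppFreq β n ^ 2 + u ^ 2) ^ 2)| ≤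
      (32 * B₁ + 18) / (Λ * (ppFreq β n ^ 2 + (Λ / 2) ^ 2)) := by
    refine (abs_sub _ _).trans (((add_le_add ((abs_add_le _ _).trans (add_le_add hT1 hT2)) hT3)).trans (le_of_eq ?_))
    have : 0 < Λ * (ppFreq β n ^ 2 + (Λ / 2) ^ 2) := by positivity
    field_simp
    ring
  calc uvWeightFn Λ (ppFreq β n) e *
        |uvWeightFnD1 Λ (ppFreq β n) u * (e * u + ppFreq β n ^ 2) / ((ppFreq β n ^ 2 + e ^ 2) * (ppFreq β n ^ 2 + u ^ 2)) +
          uvWeightFn Λ (ppFreq β n) u * e / ((ppFreq β n ^ 2 + e ^ 2) * (ppFreq β n ^ 2 + u ^ 2)) -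
          uvWeightFn Λ (ppFreq β n) u * (e * u + ppFreq β n ^ 2) * (2 * u) / ((ppFreq β n ^ 2 + e ^ 2) * (ppFreq β n ^ 2 + u ^ 2) ^ 2)|
      ≤ 1 * ((32 * B₁ + 18) / (Λ * (ppFreq β n ^ 2 + (Λ / 2) ^ 2))) := mul_le_mul hWe1 habs (abs_nonneg _) zero_le_one
    _ = _ := one_mul _

/-! ## §2 The uniform bound on the strip -/

/-- **`|e| ≤ Λ ⟹ |∂ᵤP(e,u)| ≤ (32B₁ + 18)/Λ²` for EVERY `u`** (sum of §1 against `(2/β)Σ 1/(ωₙ² + (Λ/2)²) = tanh(βΛ/4)/Λ ≤ 1/Λ`).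
[cite: BenfattoGiulianiMastropietro2006, §2.4 (2.36)] -/
theorem abs_ppTrueKernelDu_strip_le_unif {β Λ : ℝ} (hβ : 0 < β) (hΛ : 0 < Λ) {B₁ : ℝ} (hB₁ : ∀ x, |deriv salmhoferCutoff x| ≤ B₁) {e : ℝ}
    (he : |e| ≤ Λ) (u : ℝ) : |ppTrueKernelDu β Λ e u| ≤ (32 * B₁ + 18) / Λ ^ 2 := by
  have hB0 := salmhoferB₁_nonneg hB₁
  unfold ppTrueKernelDu
  set f : ℕ → ℝ := fun n => uvWeightFn Λ (ppFreq β n) e *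
      ((uvWeightFnD1 Λ (ppFreq β n) u * (e * u + ppFreq β n ^ 2) + uvWeightFn Λ (ppFreq β n) u * e) / ((ppFreq β n ^ 2 + e ^ 2) * (ppFreq β n ^ 2 + u ^ 2)) -
        uvWeightFn Λ (ppFreq β n) u * (e * u + ppFreq β n ^ 2) * (2 * u) / ((ppFreq β n ^ 2 + e ^ 2) * (ppFreq β n ^ 2 + u ^ 2) ^ 2)) with hf
  have hbd : ∀ n : ℕ, |f n| ≤ (32 * B₁ + 18) / Λ * (1 / (ppFreq β n ^ 2 + (Λ / 2) ^ 2)) := fun n => by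
    have h := abs_ppTrueKernelDu_summand_strip_le hβ hΛ hB₁ he u n
    refine h.trans (le_of_eq ?_)
    have : 0 < ppFreq β n ^ 2 + (Λ / 2) ^ 2 := by positivity
    field_simp
  have hsb : Summable fun n : ℕ => (32 * B₁ + 18) / Λ * (1 / (ppFreq β n ^ 2 + (Λ / 2) ^ 2)) :=
    (summable_one_div_ppFreq_sq_add_sq hβ (Λ / 2)).mul_left _
  have hsf : Summable f := Summable.of_norm_bounded hsb fun n => by rw [Real.norm_eq_abs]; exact hbd n
  have htsum : |∑' n : ℕ, f n| ≤ (32 * B₁ + 18) / Λ * (β * Real.tanh (β * (Λ / 2) / 2) / (4 * (Λ / 2))) := by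
    rw [← tsum_one_div_ppFreq_sq_add_sq hβ (by positivity : Λ / 2 ≠ 0), ← tsum_mul_left]
    refine (norm_tsum_le_tsum_norm hsf.norm).trans ?_
    exact Summable.tsum_le_tsum (fun n => by rw [Real.norm_eq_abs]; exact hbd n) hsf.norm hsb
  have ht : Real.tanh (β * (Λ / 2) / 2) ≤ 1 := (Real.tanh_lt_one _).le
  have hβ2 : 0 < 2 / β := by positivity
  rw [abs_mul, abs_of_pos hβ2]
  calc 2 / β * |∑' n : ℕ, f n| ≤ 2 / β * ((32 * B₁ + 18) / Λ * (β * Real.tanh (β * (Λ / 2) / 2) / (4 * (Λ / 2)))) :=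
        mul_le_mul_of_nonneg_left htsum hβ2.le
    _ = (32 * B₁ + 18) / Λ ^ 2 * Real.tanh (β * (Λ / 2) / 2) := by field_simp; ring
    _ ≤ (32 * B₁ + 18) / Λ ^ 2 * 1 := mul_le_mul_of_nonneg_left ht (by positivity)
    _ = (32 * B₁ + 18) / Λ ^ 2 := mul_one _

/-! ## §3 The far partner: `|u| ≥ 2Λ` -/

/-- **`|e| ≤ Λ`, `2Λ ≤ |u| ⟹ |∂ᵤP(e,u)| ≤ 8/u²`** (`∂ᵤP = ∂ᵤN/(e+u) − N/(e+u)²` off the anti-diagonal, `|e+u| ≥ |u|/2`, `|∂ᵤN| ≤ 2/|u|`, `|N| ≤ 1`).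
[cite: BenfattoGiulianiMastropietro2006, §2.4 (2.36)] -/
theorem abs_ppTrueKernelDu_farPartner_le {β Λ : ℝ} (hβ : 0 < β) (hΛ : 0 < Λ) {B₁ : ℝ} (hB₁ : ∀ x, |deriv salmhoferCutoff x| ≤ B₁) {e u : ℝ}
    (he : |e| ≤ Λ) (hu : 2 * Λ ≤ |u|) : |ppTrueKernelDu β Λ e u| ≤ 8 / u ^ 2 := by
  have hu0 : 0 < |u| := by linarith
  have hsum : |u| / 2 ≤ |e + u| := by
    have h1 : |u| - |e| ≤ |e + u| := by
      have := abs_sub_abs_le_abs_sub u (-e)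
      rw [abs_neg, sub_neg_eq_add, add_comm] at this
      exact this
    linarith
  have hne : e + u ≠ 0 := by
    intro h; rw [h, abs_zero] at hsum; linarith
  have hfar : Λ < |u| := by linarith
  rw [ppTrueKernelDu_eq_of_ne hβ hΛ hB₁ hne]
  have hN1 := abs_ppTrueNumeratorDu_le_two_div_abs hβ hΛ hfar e
  have hN0 := abs_ppTrueNumerator_le_one hβ Λ e u
  have hs0 : 0 < |e + u| := abs_pos.2 hne
  have h1 : |ppTrueNumeratorDu β Λ e u / (e + u)| ≤ 4 / u ^ 2 := by
    rw [abs_div]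
    calc |ppTrueNumeratorDu β Λ e u| / |e + u| ≤ (2 / |u|) / (|u| / 2) := by gcongr
      _ = 4 / |u| ^ 2 := by field_simp; ring
      _ = 4 / u ^ 2 := by rw [sq_abs]
  have h2 : |ppTrueNumerator β Λ e u / (e + u) ^ 2| ≤ 4 / u ^ 2 := by
    rw [abs_div, abs_pow]
    calc |ppTrueNumerator β Λ e u| / |e + u| ^ 2 ≤ 1 / (|u| / 2) ^ 2 := by gcongr
      _ = 4 / |u| ^ 2 := by field_simp; ring
      _ = 4 / u ^ 2 := by rw [sq_abs]
  calc |ppTrueNumeratorDu β Λ e u / (e + u) - ppTrueNumerator β Λ e u / (e + u) ^ 2|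
      ≤ |ppTrueNumeratorDu β Λ e u / (e + u)| + |ppTrueNumerator β Λ e u / (e + u) ^ 2| := abs_sub _ _
    _ ≤ 4 / u ^ 2 + 4 / u ^ 2 := add_le_add h1 h2
    _ = 8 / u ^ 2 := by ring

/-! ## §4 The scale-regular envelope on the strip -/

/-- **THE SCALE-REGULAR ENVELOPE ON THE FERMI STRIP** (HEADLINE).  `0 < β`, `0 < Λ`, `|χ′| ≤ B₁`, `|e| ≤ Λ`: for every `u ∈ ℝ`,
`|∂ᵤP(e,u)| ≤ (128B₁ + 72)·(max Λ |u|)⁻¹²` — `T`-free and `β`-free; `|u| ≤ 2Λ` by §2 (`Λ⁻² ≤ 4·max(Λ,|u|)⁻²`), `|u| ≥ 2Λ` by §3.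
[cite: BenfattoGiulianiMastropietro2006, §2.4 (2.36)] -/
theorem abs_ppTrueKernelDu_strip_le_inv_max_sq {β Λ : ℝ} (hβ : 0 < β) (hΛ : 0 < Λ) {B₁ : ℝ} (hB₁ : ∀ x, |deriv salmhoferCutoff x| ≤ B₁) {e : ℝ}
    (he : |e| ≤ Λ) (u : ℝ) : |ppTrueKernelDu β Λ e u| ≤ (128 * B₁ + 72) * (max Λ |u|)⁻¹ ^ 2 := by
  have hB0 := salmhoferB₁_nonneg hB₁
  set M : ℝ := max Λ |u| with hM
  have hMΛ : Λ ≤ M := le_max_left _ _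
  have hM0 : 0 < M := hΛ.trans_le hMΛ
  rcases le_or_gt (2 * Λ) |u| with hfar | hnear
  · have h := abs_ppTrueKernelDu_farPartner_le hβ hΛ hB₁ he hfar
    have hMu : M = |u| := max_eq_right (by linarith)
    have hu0 : 0 < |u| := by linarith
    have hune : u ≠ 0 := abs_pos.1 hu0
    have hu2 : 0 < u ^ 2 := by positivity
    rw [hMu, inv_pow, ← one_div, sq_abs]
    refine h.trans ?_
    rw [mul_one_div, div_le_div_iff_of_pos_right hu2]
    linarith
  · have h := abs_ppTrueKernelDu_strip_le_unif hβ hΛ hB₁ he u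
    have hM2 : M ≤ 2 * Λ := max_le (by linarith) hnear.le
    have hinv : 1 / Λ ^ 2 ≤ 4 * M⁻¹ ^ 2 := by
      rw [inv_pow, ← one_div, mul_one_div, div_le_div_iff₀ (by positivity) (by positivity)]
      nlinarith [pow_le_pow_left₀ hM0.le hM2 2]
    calc |ppTrueKernelDu β Λ e u| ≤ (32 * B₁ + 18) / Λ ^ 2 := h
      _ = (32 * B₁ + 18) * (1 / Λ ^ 2) := by ring
      _ ≤ (32 * B₁ + 18) * (4 * M⁻¹ ^ 2) := mul_le_mul_of_nonneg_left hinv (by positivity)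
      _ = (128 * B₁ + 72) * M⁻¹ ^ 2 := by ring

/-- **`deriv` form of the strip envelope.** [cite: BenfattoGiulianiMastropietro2006, §2.4 (2.36)] -/
theorem abs_deriv_ppTrueKernel_strip_le_inv_max_sq {β Λ : ℝ} (hβ : 0 < β) (hΛ : 0 < Λ) {B₁ : ℝ} (hB₁ : ∀ x, |deriv salmhoferCutoff x| ≤ B₁)
    {e : ℝ} (he : |e| ≤ Λ) (u : ℝ) : |deriv (fun v => ppTrueKernel β Λ e v) u| ≤ (128 * B₁ + 72) * (max Λ |u|)⁻¹ ^ 2 := by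
  rw [(hasDerivAt_ppTrueKernel_u hβ hΛ hB₁ e u).deriv]
  exact abs_ppTrueKernelDu_strip_le_inv_max_sq hβ hΛ hB₁ he u

/-- **THE STRIP ROW OF `…C4aFoldBoxPreLawStrip` FOR THE TRUE KERNEL** (binder shape, any floor `0 < lo ≤ Λ`):
`∀ e ∈ [−lo, lo], ∀ u, |deriv (P(e,·)) u| ≤ (128B₁ + 72)·(max lo |u|)⁻¹²` — the normalised row `(max lo |u|)⁻¹²` after dividing the kernel by `128B₁ + 72`.
[cite: BenfattoGiulianiMastropietro2006, §2.4 (2.36)] -/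
theorem abs_deriv_ppTrueKernel_strip_le {β Λ : ℝ} (hβ : 0 < β) (hΛ : 0 < Λ) {B₁ : ℝ} (hB₁ : ∀ x, |deriv salmhoferCutoff x| ≤ B₁)
    {lo : ℝ} (hlo : 0 < lo) (hloΛ : lo ≤ Λ) :
    ∀ e ∈ Icc (-lo) lo, ∀ u, |deriv (fun v => ppTrueKernel β Λ e v) u| ≤ (128 * B₁ + 72) * (max lo |u|)⁻¹ ^ 2 := fun e he u => by
  have hB0 := salmhoferB₁_nonneg hB₁
  have he' : |e| ≤ Λ := (abs_le.2 ⟨he.1, he.2⟩).trans hloΛ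
  have h := abs_deriv_ppTrueKernel_strip_le_inv_max_sq hβ hΛ hB₁ he' u
  have hm : max lo |u| ≤ max Λ |u| := max_le_max hloΛ le_rfl
  have hm0 : 0 < max lo |u| := hlo.trans_le (le_max_left _ _)
  have hinv : (max Λ |u|)⁻¹ ^ 2 ≤ (max lo |u|)⁻¹ ^ 2 :=
    pow_le_pow_left₀ (inv_nonneg.2 (hm0.le.trans hm)) (inv_anti₀ hm0 hm) 2
  exact h.trans (mul_le_mul_of_nonneg_left hinv (by positivity))

end Summit.HubbardSuperconductivity.HubbardSuperconductivity.Theorems.C4a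

end
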